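import Literature.MathematicalPhysics.QuantumFieldTheory.Balaban1983to89.B13OpsYPencilHolonomy
import Literature.MathematicalPhysics.QuantumFieldTheory.Balaban1983to89.B9Ineq369CurvatureSmallAtLettersY

/-!
# `Balaban1983to89.B13OpsYPencilHessian` — T. Bałaban, *Propagators for lattice gauge theories in a background field*, Commun. Math. Phys. **99** (1985)
# 389–434 [Balaban1985BackgroundPropagators], (3.2) p. 390 (the primed contour variables `A′(b_m)`), (3.7) p. 391 and (3.10) p. 392 (`⟨A, ΔA⟩ = ⟨A, D*DA⟩ +
# ⟨A, Δ′A⟩`, the commutator term `tr Σ_{b₁≺b₂} i[A′(b₁), A′(b₂)]η⁻²Im U(∂p)`), p. 396 («U′ = exp iηA′»), Thm 3.4 p. 400 («the operators … extend to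
# configurations U′U … as analytic functions of A′»), (3.50) p. 400 («Δ_{U′U}λ(x) = … an analytic function of A(b)»), (3.108) p. 416; [Balaban1988RG2Cluster]
# (2.5) p. 12, p. 15: ★★★ NODE 00's HESSIAN `hessY U = Δ(U)` OF (3.10) ALONG pv27's GROUP PENCIL `A′ ↦ prodCfg U₀ η A′ = e^{iηA′}U₀` — for every input
# field `Λ` and every bond `b`, `A′ ↦ (Δ(e^{iηA′}U₀)Λ)(b)` is HOLOMORPHIC on every chart ball `‖A′‖ < R` with an explicit bound; the commutator term
# `Δ′₂` (`curv2Y`) unfolded and treated first; the coordinates of `Δ(e^{iηA′}U₀)` in the N10 currency.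

statement-level complex analysis ([folklore]: finite sums, products, scalar multiples, conjugations of holomorphic bounded Banach-algebra-valued maps) AT
NODE 00's `rfl`-level definitions (`edgeY sgnY edgeParY primeEdgeY commY curv2Y hessY`) over `B13OpsYPencilHolonomy` (holonomies, Jordan insertion, the
`D* 𝒦 D` term) and `B13OpsYPencilLetters` (the pencil's letters); kernel-checked; THEOREMS ONLY (no `def`, no `structure`, no instance, no notation);
NOTHING of NODE 00's ∕ pv27's is modified — consumed BY NAME; nothing here is a claim about the Yang–Mills mass gap; no node is discharged; count-neutral.

WHY THIS FILE (cell `pub-ymgap`, HUMAN RULING D-0062 ∕ D-0149, Track A node N10 = [B13]; seat `pub-ymgap-dag-n10-c` g14, INTENT-4; census v16 item 1).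
The three previous modules of the seat (68 `B13TransportedLiftLetters`, 69 `B13OpsYPencilLetters`, 70 `B13OpsYPencilHolonomy`) read NODE 00's local letters and
the first Hessian term along the pencil; THIS FILE closes the Hessian: the commutator part `curv2Y` (edge transports, primed edges, the indicator double sum)
and `hessY = (coCurlY ∘ jordanY ∘ curlY) + curv2Y`.  The result is print's (3.50) sentence — «Δ_{U′U} … an analytic function of A» — kernel-checked AT
NODE 00's operator of record `Node00.hessY`, along pv27's DEFINITION of `U′U`, with explicit majorants in the background's size `K₀`, the chart radius, the
flat kernels' row sums and the plaquette incidence count.  For the N10 junction this is the LOCAL-piece letter of any term built on `Δ(U)`: §4 gives the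
coordinates `A′ ↦ φ_k((Δ(e^{iηA′}U₀)(δ_x ⊗ e_l))(y))` holomorphic and bounded (the `hEL` shape, up to the piece's formula of record and the square
packaging of module 68).

WHAT THIS FILE PROVES (all `theorem`s; `𝔸` NODE 00's complete normed `ℂ`-algebra with `‖1‖ = 1`).
* §1 EDGE TRANSPORTS AND PRIMED EDGES along the pencil: `differentiableOn_edgeParY_prodCfg ∕ _inv_prodCfg` (the four contour transports `V_m ∈ {U_ν(x), 1, 1,
  U_μ(x)}` and inverses), `norm_edgeParY_prodCfg_le ∕ _inv_prodCfg_le` (`≤ Kη := K₀e^{|η|R}`), n06's `B9Ineq369CurvatureSmallAtLettersY.norm_sgnY` (`‖σ_m‖ = 1`, BY NAME), `primeEdgeY_apply` (`A′(b_m)(Λ) =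
  σ_m·R(V_m)(Λ(b_m))`, definition), `differentiableOn_primeEdgeY_prodCfg`, `norm_primeEdgeY_prodCfg_le` (`≤ Kη·‖Λ‖·Kη`), `commY_apply` (`i(X·M − M·X)`),
  `norm_commY_le` (`≤ 2‖M‖‖X‖`).
* §2 ★ `curv2Y_apply` — NODE 00's `Δ′₂(U)Λ(b) = ½ Σ_p Σ_m 1_{b_m(p) = b}·σ_m·R(V_m⁻¹)(i[Σ_{l≻m}A′_l(Λ) − Σ_{l≺m}A′_l(Λ), c_f²·Im U(∂p)])` UNFOLDED;
  ★★ `differentiableOn_curv2Y_prodCfg` (`A′ ↦ (Δ′₂(e^{iηA′}U₀)Λ)(b)` holomorphic on every ball), ★★ `norm_curv2Y_prodCfg_le` (`≤ ½·N_b·(Kη·(2·c_f²Kη⁴·(8·Kη²‖Λ‖))·Kη)`,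
  `N_b` ≥ the number of pairs `(p,m)` with `b_m(p) = b`).
* §3 ★★★ `hessY_apply_eq` (`Δ(U)Λ b = (D* 𝒦 D Λ)(b) + (Δ′₂Λ)(b)`, definition), ★★★ `differentiableOn_hessY_prodCfg` — `A′ ↦ (Δ(e^{iηA′}U₀)Λ)(b)` HOLOMORPHIC on
  `‖A′‖ < R` for every `Λ`, `b` —, ★★★ `norm_hessY_prodCfg_le` (sum of the two majorants).
* §4 THE N10 COORDINATES: `differentiableOn_coord_hessY_prodCfg` (`A′ ↦ φ_k((Δ(e^{iηA′}U₀)(δ_x ⊗ e_l))(y))` holomorphic), `norm_coord_hessY_prodCfg_le`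
  (`≤ ‖φ_k‖·(majorant at ‖Λ‖ = ‖e_l‖)`, `Pi.norm_single`).
HONEST FRAMING: NODE 00's DEFINITIONS read along pv27's DEFINITION of the pencil; inputs are numerals (`K₀ ≥ 1`, `R`, row sums `c₁ c₂ ≥ 0`, incidence count
`N_b`, `c_f`); nothing of Bałaban's asserted (the ESTIMATES of Thm 3.4 for `Δ(U)`-built propagators are N06's; here only the formula-level analyticity of the
LOCAL operator is kernel-checked at NODE 00's objects); whether `hessY` (the SKEW∕`lieSU` compression of n07-w1's `hessOpAt` aside) is the operator the N10
term of record uses is NODE 00's ∕ def-T's reading; N06 ∕ N07 ∕ N10 NOT discharged; K1⁷ NOT closed; counts unmoved (typed 28∕28 · discharged 5∕27); no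
`sorry`, no new named fact; standard axioms; one finite 𝕋⁴ programme at fixed ε, Bałaban AS PRINTED; the YM mass gap (Clay) is NOT proved by any of this —
R4 closes the conditional finite-𝕋⁴ rung `BalabanLadder.UV` only; nothing continuum ∕ ℝ⁴ ∕ OS.

References: T. Bałaban, CMP 99 (1985) 389–434 [Balaban1985BackgroundPropagators] (3.2) p.390, (3.7) p.391, (3.10) p.392, p.396, Thm 3.4 and (3.50) p.400,
(3.108) p.416; CMP 116 (1988) 1–22 [Balaban1988RG2Cluster] (2.5) p.12, p.15.
-/

noncomputable section

namespace Literature.MathematicalPhysics.QuantumFieldTheory.Balaban1983to89.B13OpsYPencilHessian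

open Metric Set Complex
open NormedSpace (exp)
open Literature.MathematicalPhysics.QuantumFieldTheory.Balaban1983to89
open Literature.MathematicalPhysics.QuantumFieldTheory.Balaban1983to89.B9Eq39Adjoint (R R_def prodCfg)
open Literature.MathematicalPhysics.QuantumFieldTheory.Balaban1983to89.B6GlobalChartV1 (PV boxEquiv)
open Literature.MathematicalPhysics.QuantumFieldTheory.Balaban1983to89.B6KLevelCensusIndexV1 (KIdx)
open Literature.MathematicalPhysics.QuantumFieldTheory.Balaban1983to89.Node00
  (SiteY FBondY PlaqY CfgY curlK cocurlK curlY coCurlY imHolY jordanY edgeY sgnY edgeParY primeEdgeY commY curv2Y hessY RL)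
open Literature.MathematicalPhysics.QuantumFieldTheory.Balaban1983to89.B13OpsYPencilLetters
  (differentiableOn_prodCfg_apply differentiableOn_prodCfg_inv_apply norm_prodCfg_apply_le norm_prodCfg_inv_apply_le)
open Literature.MathematicalPhysics.QuantumFieldTheory.Balaban1983to89.B13OpsYPencilHolonomy
  (differentiableOn_imHolY_prodCfg norm_imHolY_prodCfg_le differentiableOn_dKd_prodCfg norm_dKd_prodCfg_le)
open Literature.MathematicalPhysics.QuantumFieldTheory.Balaban1983to89.B9Ineq369CurvatureSmallAtLettersY (norm_sgnY)

variable {𝔸 : Type} [NormedRing 𝔸] [NormedAlgebra ℂ 𝔸] [CompleteSpace 𝔸]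
variable {d ℓ : ℕ} {hd : 1 ≤ d + 1} {hL : Odd (ℓ + 1) ∧ 1 < ℓ + 1} {b₀ b₁ : ℝ}
variable (i : KIdx d ℓ hd hL b₀ b₁) (U₀ : CfgY 𝔸 i) (η : ℝ) {Rc K₀ : ℝ}

/-! ## §1. Edge transports, primed edges, the commutator insertion along the pencil -/

section Edges

/-- The four contour transports `V_m(p) ∈ {U_ν(x), 1, 1, U_μ(x)}` at `U = e^{iηA′}U₀` are holomorphic in `A′` on every ball.
[cite: Balaban1985BackgroundPropagators, (3.2) p.390, Thm 3.4 p.400] -/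
theorem differentiableOn_edgeParY_prodCfg (p : PlaqY i) (m : Fin 4) :
    DifferentiableOn ℂ (fun a => (edgeParY i (prodCfg U₀ η a) p m : 𝔸)) (ball (0 : Fin (d + 1) → Site (PV d ℓ i.m i.K hd hL) 0 → 𝔸) Rc) := by
  fin_cases m
  · simpa [edgeParY] using differentiableOn_prodCfg_apply i U₀ η (Rc := Rc) p.ν p.src
  · simp [edgeParY]
  · simp [edgeParY]
  · simpa [edgeParY] using differentiableOn_prodCfg_apply i U₀ η (Rc := Rc) p.μ p.src

/-- … and so are their inverses. [cite: Balaban1985BackgroundPropagators, (3.2) p.390, (3.5) p.391, Thm 3.4 p.400] -/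
theorem differentiableOn_edgeParY_inv_prodCfg (p : PlaqY i) (m : Fin 4) :
    DifferentiableOn ℂ (fun a => (((edgeParY i (prodCfg U₀ η a) p m)⁻¹ : 𝔸ˣ) : 𝔸))
      (ball (0 : Fin (d + 1) → Site (PV d ℓ i.m i.K hd hL) 0 → 𝔸) Rc) := by
  fin_cases m
  · simpa [edgeParY] using differentiableOn_prodCfg_inv_apply i U₀ η (Rc := Rc) p.ν p.src
  · simp [edgeParY]
  · simp [edgeParY]
  · simpa [edgeParY] using differentiableOn_prodCfg_inv_apply i U₀ η (Rc := Rc) p.μ p.src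

variable [NormOneClass 𝔸]

/-- On `‖A′‖ < R`: `‖V_m(p)‖ ≤ K₀e^{|η|R}` once `‖U₀(b)‖ ≤ K₀`, `1 ≤ K₀`. [cite: Balaban1985BackgroundPropagators, (3.2) p.390, (3.35)–(3.37) p.396] -/
theorem norm_edgeParY_prodCfg_le (hU : ∀ μ x, ‖(U₀ μ x : 𝔸)‖ ≤ K₀) (hK1 : 1 ≤ K₀) (hRc : 0 ≤ Rc)
    {a : Fin (d + 1) → Site (PV d ℓ i.m i.K hd hL) 0 → 𝔸} (ha : a ∈ ball 0 Rc) (p : PlaqY i) (m : Fin 4) :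
    ‖(edgeParY i (prodCfg U₀ η a) p m : 𝔸)‖ ≤ K₀ * Real.exp (|η| * Rc) := by
  have h1 : (1 : ℝ) ≤ K₀ * Real.exp (|η| * Rc) :=
    one_le_mul_of_one_le_of_one_le hK1 (Real.one_le_exp (mul_nonneg (abs_nonneg _) hRc))
  fin_cases m
  · simpa [edgeParY] using norm_prodCfg_apply_le i U₀ η hU hRc a ha p.ν p.src
  · simpa [edgeParY] using h1
  · simpa [edgeParY] using h1
  · simpa [edgeParY] using norm_prodCfg_apply_le i U₀ η hU hRc a ha p.μ p.src

/-- On `‖A′‖ < R`: `‖V_m(p)⁻¹‖ ≤ K₀e^{|η|R}` once `‖U₀(b)⁻¹‖ ≤ K₀`, `1 ≤ K₀`. [cite: Balaban1985BackgroundPropagators, (3.2) p.390, (3.5) p.391, (3.35)–(3.37) p.396] -/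
theorem norm_edgeParY_inv_prodCfg_le (hUi : ∀ μ x, ‖(((U₀ μ x)⁻¹ : 𝔸ˣ) : 𝔸)‖ ≤ K₀) (hK1 : 1 ≤ K₀) (hRc : 0 ≤ Rc)
    {a : Fin (d + 1) → Site (PV d ℓ i.m i.K hd hL) 0 → 𝔸} (ha : a ∈ ball 0 Rc) (p : PlaqY i) (m : Fin 4) :
    ‖(((edgeParY i (prodCfg U₀ η a) p m)⁻¹ : 𝔸ˣ) : 𝔸)‖ ≤ K₀ * Real.exp (|η| * Rc) := by
  have h1 : (1 : ℝ) ≤ K₀ * Real.exp (|η| * Rc) :=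
    one_le_mul_of_one_le_of_one_le hK1 (Real.one_le_exp (mul_nonneg (abs_nonneg _) hRc))
  fin_cases m
  · simpa [edgeParY] using norm_prodCfg_inv_apply_le i U₀ η hUi hRc a ha p.ν p.src
  · simpa [edgeParY] using h1
  · simpa [edgeParY] using h1
  · simpa [edgeParY] using norm_prodCfg_inv_apply_le i U₀ η hUi hRc a ha p.μ p.src

omit [NormOneClass 𝔸] in
/-- **NODE 00's PRIMED EDGE, UNFOLDED**: `A′(b_m)(Λ) = σ_m · R(V_m)(Λ(b_m))` (general-`𝔸` form of lit's matrix-case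
`B9Thm311Curv2Symm.primeEdgeY_apply`; both `rfl`). [cite: Balaban1985BackgroundPropagators, (3.2) p.390] -/
theorem primeEdgeY_apply (U : CfgY 𝔸 i) (p : PlaqY i) (m : Fin 4) (Λ : FBondY i → 𝔸) :
    primeEdgeY i U p m Λ = sgnY m • R (edgeParY i U p m) (Λ (edgeY i p m)) := rfl

omit [NormOneClass 𝔸] in
/-- `A′ ↦ A′(b_m)(Λ)` at `U = e^{iηA′}U₀` is holomorphic on every ball, for every field `Λ`.
[cite: Balaban1985BackgroundPropagators, (3.2) p.390, Thm 3.4 p.400] -/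
theorem differentiableOn_primeEdgeY_prodCfg (p : PlaqY i) (m : Fin 4) (Λ : FBondY i → 𝔸) :
    DifferentiableOn ℂ (fun a => primeEdgeY i (prodCfg U₀ η a) p m Λ) (ball (0 : Fin (d + 1) → Site (PV d ℓ i.m i.K hd hL) 0 → 𝔸) Rc) := by
  simp only [primeEdgeY_apply, R_def]
  exact (((differentiableOn_edgeParY_prodCfg i U₀ η p m).mul (differentiableOn_const _)).mul
    (differentiableOn_edgeParY_inv_prodCfg i U₀ η p m)).const_smul (sgnY m)

/-- On `‖A′‖ < R`: `‖A′(b_m)(Λ)‖ ≤ Kη·‖Λ‖·Kη`, `Kη = K₀e^{|η|R}`. [cite: Balaban1985BackgroundPropagators, (3.2) p.390, Thm 3.4 p.400] -/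
theorem norm_primeEdgeY_prodCfg_le (hU : ∀ μ x, ‖(U₀ μ x : 𝔸)‖ ≤ K₀) (hUi : ∀ μ x, ‖(((U₀ μ x)⁻¹ : 𝔸ˣ) : 𝔸)‖ ≤ K₀) (hK1 : 1 ≤ K₀)
    (hRc : 0 ≤ Rc) {a : Fin (d + 1) → Site (PV d ℓ i.m i.K hd hL) 0 → 𝔸} (ha : a ∈ ball 0 Rc) (p : PlaqY i) (m : Fin 4)
    (Λ : FBondY i → 𝔸) :
    ‖primeEdgeY i (prodCfg U₀ η a) p m Λ‖ ≤ K₀ * Real.exp (|η| * Rc) * ‖Λ‖ * (K₀ * Real.exp (|η| * Rc)) := by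
  rw [primeEdgeY_apply, norm_smul, norm_sgnY, one_mul, R_def]
  have hf := norm_edgeParY_prodCfg_le i U₀ η hU hK1 hRc ha p m
  have hb := norm_edgeParY_inv_prodCfg_le i U₀ η hUi hK1 hRc ha p m
  have h0 : 0 ≤ K₀ * Real.exp (|η| * Rc) := (norm_nonneg _).trans hf
  calc ‖(edgeParY i (prodCfg U₀ η a) p m : 𝔸) * Λ (edgeY i p m) * (((edgeParY i (prodCfg U₀ η a) p m)⁻¹ : 𝔸ˣ) : 𝔸)‖
      ≤ ‖(edgeParY i (prodCfg U₀ η a) p m : 𝔸) * Λ (edgeY i p m)‖ * ‖(((edgeParY i (prodCfg U₀ η a) p m)⁻¹ : 𝔸ˣ) : 𝔸)‖ :=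
        norm_mul_le _ _
    _ ≤ K₀ * Real.exp (|η| * Rc) * ‖Λ‖ * (K₀ * Real.exp (|η| * Rc)) :=
        mul_le_mul ((norm_mul_le _ _).trans (mul_le_mul hf (norm_le_pi_norm Λ _) (norm_nonneg _) h0)) hb (norm_nonneg _)
          (mul_nonneg h0 (norm_nonneg _))

omit [CompleteSpace 𝔸] [NormOneClass 𝔸] in
/-- **NODE 00's COMMUTATOR INSERTION, UNFOLDED**: `commY M X = i(X·M − M·X)` (general-`𝔸` form of `B9Thm311Curv2Symm.commY_apply`; `rfl`).
[cite: Balaban1985BackgroundPropagators, (3.10) p.392] -/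
theorem commY_apply (M X : 𝔸) :
    commY M X = Complex.I • (X * M - M * X) := rfl

omit [CompleteSpace 𝔸] [NormOneClass 𝔸] in
/-- `‖i[X, M]‖ ≤ 2‖M‖‖X‖`. [cite: Balaban1985BackgroundPropagators, (3.10) p.392] -/
theorem norm_commY_le (M X : 𝔸) :
    ‖commY M X‖ ≤ 2 * ‖M‖ * ‖X‖ := by
  rw [commY_apply, norm_smul, Complex.norm_I, one_mul]
  calc ‖X * M - M * X‖ ≤ ‖X * M‖ + ‖M * X‖ := norm_sub_le _ _
    _ ≤ ‖X‖ * ‖M‖ + ‖M‖ * ‖X‖ := add_le_add (norm_mul_le _ _) (norm_mul_le _ _)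
    _ = 2 * ‖M‖ * ‖X‖ := by ring

end Edges

/-! ## §2. ★ The commutator part `Δ′₂(U)` (`curv2Y`) along the pencil -/

section Curv2

open Classical in
/-- ★ **NODE 00's `Δ′₂(U)`, UNFOLDED**: `(Δ′₂(U)Λ)(b) = ½ Σ_p Σ_m 1_{b_m(p) = b}·σ_m·R(V_m⁻¹)(i[(Σ_{l≻m}A′_l)(Λ) − (Σ_{l≺m}A′_l)(Λ), c_f²·Im U(∂p)])`
(the operator of the polarised commutator term of (3.10) for the trace pairing, NODE 00's `curv2Y`; general-`𝔸` form of lit's matrix-case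
`B9Thm311Curv2Symm.curv2Y_apply`, which packages the two partial sums as `contourSum` — here they stay displayed, as the holomorphy proof reads them).
[cite: Balaban1985BackgroundPropagators, (3.10) p.392, (3.2) p.390] -/
theorem curv2Y_apply (U : CfgY 𝔸 i) (Λ : FBondY i → 𝔸) (b : FBondY i) :
    curv2Y i U Λ b = (1 / 2 : ℂ) • ∑ p : PlaqY i, ∑ m : Fin 4,
      if edgeY i p m = b then
        sgnY m • R (edgeParY i U p m)⁻¹ (commY (((i.cf ^ 2 : ℝ) : ℂ) • imHolY i U p)
          ((∑ l : Fin 4, if m < l then primeEdgeY i U p l else 0) Λ - (∑ l : Fin 4, if l < m then primeEdgeY i U p l else 0) Λ))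
      else 0 := by
  simp only [curv2Y, LinearMap.smul_apply, LinearMap.pi_apply, LinearMap.coe_sum, Finset.sum_apply, Pi.smul_apply]
  congr 1
  refine Finset.sum_congr rfl fun p _ => Finset.sum_congr rfl fun m _ => ?_
  split_ifs
  · rfl
  · rfl

/-- The partial sums `Σ_{l ≻ m} A′_l(Λ)` ∕ `Σ_{l ≺ m} A′_l(Λ)` evaluated (plumbing: a finite sum of linear maps applied). [cite: Balaban1985BackgroundPropagators, (3.10) p.392] -/
private theorem sum_ite_primeEdgeY_apply (U : CfgY 𝔸 i) (p : PlaqY i) (Λ : FBondY i → 𝔸) (P : Fin 4 → Prop) [DecidablePred P] :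
    (∑ l : Fin 4, if P l then primeEdgeY i U p l else 0) Λ = ∑ l : Fin 4, if P l then primeEdgeY i U p l Λ else 0 := by
  rw [LinearMap.coe_sum, Finset.sum_apply]
  refine Finset.sum_congr rfl fun l _ => ?_
  split_ifs <;> rfl

/-- The partial sums `A′ ↦ (Σ_{l : P l} A′_l)(Λ)` at `U = e^{iηA′}U₀` are holomorphic. [cite: Balaban1985BackgroundPropagators, (3.2) p.390, (3.10) p.392, Thm 3.4 p.400] -/
theorem differentiableOn_sum_primeEdgeY_prodCfg (p : PlaqY i) (Λ : FBondY i → 𝔸) (P : Fin 4 → Prop) [DecidablePred P] :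
    DifferentiableOn ℂ (fun a => (∑ l : Fin 4, if P l then primeEdgeY i (prodCfg U₀ η a) p l else 0) Λ)
      (ball (0 : Fin (d + 1) → Site (PV d ℓ i.m i.K hd hL) 0 → 𝔸) Rc) := by
  simp only [sum_ite_primeEdgeY_apply]
  refine DifferentiableOn.fun_sum fun l _ => ?_
  split_ifs
  · exact differentiableOn_primeEdgeY_prodCfg i U₀ η p l Λ
  · exact differentiableOn_const _

variable [NormOneClass 𝔸]

/-- … and bounded by `4·(Kη·‖Λ‖·Kη)` on `‖A′‖ < R`. [cite: Balaban1985BackgroundPropagators, (3.2) p.390, (3.10) p.392, Thm 3.4 p.400] -/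
theorem norm_sum_primeEdgeY_prodCfg_le (hU : ∀ μ x, ‖(U₀ μ x : 𝔸)‖ ≤ K₀) (hUi : ∀ μ x, ‖(((U₀ μ x)⁻¹ : 𝔸ˣ) : 𝔸)‖ ≤ K₀) (hK1 : 1 ≤ K₀)
    (hRc : 0 ≤ Rc) {a : Fin (d + 1) → Site (PV d ℓ i.m i.K hd hL) 0 → 𝔸} (ha : a ∈ ball 0 Rc) (p : PlaqY i) (Λ : FBondY i → 𝔸)
    (P : Fin 4 → Prop) [DecidablePred P] :
    ‖(∑ l : Fin 4, if P l then primeEdgeY i (prodCfg U₀ η a) p l else 0) Λ‖ ≤ 4 * (K₀ * Real.exp (|η| * Rc) * ‖Λ‖ * (K₀ * Real.exp (|η| * Rc))) := by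
  rw [sum_ite_primeEdgeY_apply]
  have h0 : 0 ≤ K₀ * Real.exp (|η| * Rc) * ‖Λ‖ * (K₀ * Real.exp (|η| * Rc)) := by
    have h1 : 0 ≤ K₀ * Real.exp (|η| * Rc) := mul_nonneg (zero_le_one.trans hK1) (Real.exp_nonneg _)
    exact mul_nonneg (mul_nonneg h1 (norm_nonneg _)) h1
  refine (norm_sum_le _ _).trans ?_
  calc ∑ l : Fin 4, ‖if P l then primeEdgeY i (prodCfg U₀ η a) p l Λ else 0‖
      ≤ ∑ _l : Fin 4, K₀ * Real.exp (|η| * Rc) * ‖Λ‖ * (K₀ * Real.exp (|η| * Rc)) := by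
        refine Finset.sum_le_sum fun l _ => ?_
        split_ifs
        · exact norm_primeEdgeY_prodCfg_le i U₀ η hU hUi hK1 hRc ha p l Λ
        · rw [norm_zero]; exact h0
    _ = 4 * (K₀ * Real.exp (|η| * Rc) * ‖Λ‖ * (K₀ * Real.exp (|η| * Rc))) := by
        rw [Finset.sum_const, Finset.card_univ, Fintype.card_fin]; simp

open Classical in
omit [NormOneClass 𝔸] in
/-- ★★ **`Δ′₂(e^{iηA′}U₀)Λ(b)` IS HOLOMORPHIC IN `A′`** on every chart ball, for every field `Λ` and bond `b` — the commutator term of (3.10) as an «analytic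
function of A′» at NODE 00's `curv2Y` (finite sums over plaquettes and contour positions of: orientation sign × conjugation by the inverse edge transport
of the commutator of the primed-edge partial sums with `c_f²·Im U(∂p)` — every ingredient holomorphic by §1 and `B13OpsYPencilHolonomy`).
[cite: Balaban1985BackgroundPropagators, (3.10) p.392, Thm 3.4 and (3.50) p.400] -/
theorem differentiableOn_curv2Y_prodCfg (Λ : FBondY i → 𝔸) (b : FBondY i) :
    DifferentiableOn ℂ (fun a => curv2Y i (prodCfg U₀ η a) Λ b) (ball (0 : Fin (d + 1) → Site (PV d ℓ i.m i.K hd hL) 0 → 𝔸) Rc) := by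
  simp only [curv2Y_apply]
  refine (DifferentiableOn.fun_sum fun p _ => DifferentiableOn.fun_sum fun m _ => ?_).const_smul (1 / 2 : ℂ)
  split_ifs
  · simp only [R_def, commY_apply]
    refine (((differentiableOn_edgeParY_inv_prodCfg i U₀ η p m).mul ?_).mul ?_).const_smul (sgnY m)
    · refine (DifferentiableOn.sub (DifferentiableOn.mul ?_ ?_) (DifferentiableOn.mul ?_ ?_)).const_smul Complex.I
      · exact (differentiableOn_sum_primeEdgeY_prodCfg i U₀ η p Λ _).sub (differentiableOn_sum_primeEdgeY_prodCfg i U₀ η p Λ _)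
      · exact (differentiableOn_imHolY_prodCfg i U₀ η p).const_smul (((i.cf ^ 2 : ℝ) : ℂ))
      · exact (differentiableOn_imHolY_prodCfg i U₀ η p).const_smul (((i.cf ^ 2 : ℝ) : ℂ))
      · exact (differentiableOn_sum_primeEdgeY_prodCfg i U₀ η p Λ _).sub (differentiableOn_sum_primeEdgeY_prodCfg i U₀ η p Λ _)
    · simpa only [inv_inv] using differentiableOn_edgeParY_prodCfg i U₀ η (Rc := Rc) p m
  · exact differentiableOn_const _

open Classical in
/-- ★★ **… WITH THE BOUND** `‖Δ′₂(e^{iηA′}U₀)Λ(b)‖ ≤ ½·N_b·(Kη·(2·(c_f²·Kη⁴)·(8·(Kη·‖Λ‖·Kη)))·Kη)` on `‖A′‖ < R`, `Kη = K₀e^{|η|R}`, `N_b ≥ #{(p,m) : b_m(p) = b}`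
(the plaquette incidence count of the bond `b`). [cite: Balaban1985BackgroundPropagators, (3.10) p.392, Thm 3.4 p.400, (3.108) p.416] -/
theorem norm_curv2Y_prodCfg_le (hU : ∀ μ x, ‖(U₀ μ x : 𝔸)‖ ≤ K₀) (hUi : ∀ μ x, ‖(((U₀ μ x)⁻¹ : 𝔸ˣ) : 𝔸)‖ ≤ K₀) (hK1 : 1 ≤ K₀)
    (hRc : 0 ≤ Rc) {Nb : ℝ} (b : FBondY i)
    (hNb : (((Finset.univ : Finset (PlaqY i)) ×ˢ (Finset.univ : Finset (Fin 4))).filter fun pm => edgeY i pm.1 pm.2 = b).card ≤ Nb)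
    (Λ : FBondY i → 𝔸) {a : Fin (d + 1) → Site (PV d ℓ i.m i.K hd hL) 0 → 𝔸} (ha : a ∈ ball 0 Rc) :
    ‖curv2Y i (prodCfg U₀ η a) Λ b‖ ≤ 1 / 2 * (Nb * (K₀ * Real.exp (|η| * Rc) *
      (2 * (i.cf ^ 2 * (K₀ * Real.exp (|η| * Rc)) ^ 4) * (8 * (K₀ * Real.exp (|η| * Rc) * ‖Λ‖ * (K₀ * Real.exp (|η| * Rc))))) *
      (K₀ * Real.exp (|η| * Rc)))) := by
  set Kη : ℝ := K₀ * Real.exp (|η| * Rc) with hKη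
  have h0 : 0 ≤ Kη := mul_nonneg (zero_le_one.trans hK1) (Real.exp_nonneg _)
  -- the per-term majorant
  set B : ℝ := Kη * (2 * (i.cf ^ 2 * Kη ^ 4) * (8 * (Kη * ‖Λ‖ * Kη))) * Kη with hB
  have hB0 : 0 ≤ B := by positivity
  have hterm : ∀ p m, ‖sgnY m • R (edgeParY i (prodCfg U₀ η a) p m)⁻¹ (commY (((i.cf ^ 2 : ℝ) : ℂ) • imHolY i (prodCfg U₀ η a) p)
      ((∑ l : Fin 4, if m < l then primeEdgeY i (prodCfg U₀ η a) p l else 0) Λ -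
        (∑ l : Fin 4, if l < m then primeEdgeY i (prodCfg U₀ η a) p l else 0) Λ))‖ ≤ B := by
    intro p m
    rw [norm_smul, norm_sgnY, one_mul, R_def]
    have hV := norm_edgeParY_inv_prodCfg_le i U₀ η hUi hK1 hRc ha p m
    have hVi : ‖((((edgeParY i (prodCfg U₀ η a) p m)⁻¹)⁻¹ : 𝔸ˣ) : 𝔸)‖ ≤ Kη := by
      rw [inv_inv]; exact norm_edgeParY_prodCfg_le i U₀ η hU hK1 hRc ha p m
    have hM : ‖((i.cf ^ 2 : ℝ) : ℂ) • imHolY i (prodCfg U₀ η a) p‖ ≤ i.cf ^ 2 * Kη ^ 4 := by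
      rw [norm_smul, Complex.norm_real, Real.norm_eq_abs, abs_of_nonneg (sq_nonneg _)]
      exact mul_le_mul_of_nonneg_left (norm_imHolY_prodCfg_le i U₀ η hU hUi hRc ha p) (sq_nonneg _)
    have hX : ‖(∑ l : Fin 4, if m < l then primeEdgeY i (prodCfg U₀ η a) p l else 0) Λ -
        (∑ l : Fin 4, if l < m then primeEdgeY i (prodCfg U₀ η a) p l else 0) Λ‖ ≤ 8 * (Kη * ‖Λ‖ * Kη) := by
      refine (norm_sub_le _ _).trans ?_
      have h1 := norm_sum_primeEdgeY_prodCfg_le i U₀ η hU hUi hK1 hRc ha p Λ (fun l => m < l)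
      have h2 := norm_sum_primeEdgeY_prodCfg_le i U₀ η hU hUi hK1 hRc ha p Λ (fun l => l < m)
      linarith
    have hC := (norm_commY_le (((i.cf ^ 2 : ℝ) : ℂ) • imHolY i (prodCfg U₀ η a) p)
      ((∑ l : Fin 4, if m < l then primeEdgeY i (prodCfg U₀ η a) p l else 0) Λ -
        (∑ l : Fin 4, if l < m then primeEdgeY i (prodCfg U₀ η a) p l else 0) Λ)).trans
      (mul_le_mul (mul_le_mul_of_nonneg_left hM zero_le_two) hX (norm_nonneg _) (by positivity))
    calc _ ≤ ‖(((edgeParY i (prodCfg U₀ η a) p m)⁻¹ : 𝔸ˣ) : 𝔸) * commY (((i.cf ^ 2 : ℝ) : ℂ) • imHolY i (prodCfg U₀ η a) p)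
              ((∑ l : Fin 4, if m < l then primeEdgeY i (prodCfg U₀ η a) p l else 0) Λ -
                (∑ l : Fin 4, if l < m then primeEdgeY i (prodCfg U₀ η a) p l else 0) Λ)‖ *
            ‖((((edgeParY i (prodCfg U₀ η a) p m)⁻¹)⁻¹ : 𝔸ˣ) : 𝔸)‖ := norm_mul_le _ _
      _ ≤ Kη * (2 * (i.cf ^ 2 * Kη ^ 4) * (8 * (Kη * ‖Λ‖ * Kη))) * Kη :=
          mul_le_mul ((norm_mul_le _ _).trans (mul_le_mul hV hC (norm_nonneg _) h0)) hVi (norm_nonneg _) (by positivity)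
  rw [curv2Y_apply, norm_smul]
  have hc : ‖(1 / 2 : ℂ)‖ = 1 / 2 := by norm_num
  rw [hc]
  refine mul_le_mul_of_nonneg_left ?_ (by norm_num)
  -- the indicator double sum: each surviving term ≤ B, the survivors counted by `Nb`
  have hsum : ∑ p : PlaqY i, ∑ m : Fin 4, (if edgeY i p m = b then B else 0) =
      ((((Finset.univ : Finset (PlaqY i)) ×ˢ (Finset.univ : Finset (Fin 4))).filter fun pm => edgeY i pm.1 pm.2 = b).card : ℝ) * B := by
    have h := Finset.sum_product' (s := (Finset.univ : Finset (PlaqY i))) (t := (Finset.univ : Finset (Fin 4)))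
      (f := fun p m => if edgeY i p m = b then B else 0)
    rw [← h, ← Finset.sum_filter, Finset.sum_const, nsmul_eq_mul]
  calc ‖∑ p : PlaqY i, ∑ m : Fin 4, (if edgeY i p m = b then
          sgnY m • R (edgeParY i (prodCfg U₀ η a) p m)⁻¹ (commY (((i.cf ^ 2 : ℝ) : ℂ) • imHolY i (prodCfg U₀ η a) p)
            ((∑ l : Fin 4, if m < l then primeEdgeY i (prodCfg U₀ η a) p l else 0) Λ -
              (∑ l : Fin 4, if l < m then primeEdgeY i (prodCfg U₀ η a) p l else 0) Λ)) else 0)‖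
      ≤ ∑ p : PlaqY i, ∑ m : Fin 4, ‖(if edgeY i p m = b then
          sgnY m • R (edgeParY i (prodCfg U₀ η a) p m)⁻¹ (commY (((i.cf ^ 2 : ℝ) : ℂ) • imHolY i (prodCfg U₀ η a) p)
            ((∑ l : Fin 4, if m < l then primeEdgeY i (prodCfg U₀ η a) p l else 0) Λ -
              (∑ l : Fin 4, if l < m then primeEdgeY i (prodCfg U₀ η a) p l else 0) Λ)) else 0)‖ :=
        (norm_sum_le _ _).trans (Finset.sum_le_sum fun p _ => norm_sum_le _ _)
    _ ≤ ∑ p : PlaqY i, ∑ m : Fin 4, (if edgeY i p m = b then B else 0) := by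
        refine Finset.sum_le_sum fun p _ => Finset.sum_le_sum fun m _ => ?_
        split_ifs
        · exact hterm p m
        · rw [norm_zero]
    _ = ((((Finset.univ : Finset (PlaqY i)) ×ˢ (Finset.univ : Finset (Fin 4))).filter fun pm => edgeY i pm.1 pm.2 = b).card : ℝ) * B := hsum
    _ ≤ Nb * B := mul_le_mul_of_nonneg_right hNb hB0

end Curv2

/-! ## §3. ★★★ The Hessian `Δ(U)` of (3.10) along the pencil -/

section Hessian

variable {c₁ c₂ : ℝ}

/-- **NODE 00's HESSIAN, APPLIED**: `(Δ(U)Λ)(b) = ((D*_U ∘ 𝒦_U ∘ D^η_U)Λ)(b) + (Δ′₂(U)Λ)(b)` (definition `hessY U = coCurlY U ∘ₗ jordanY U ∘ₗ curlY U + curv2Y U`).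
[cite: Balaban1985BackgroundPropagators, (3.10) p.392] -/
theorem hessY_apply_eq (U : CfgY 𝔸 i) (Λ : FBondY i → 𝔸) (b : FBondY i) :
    hessY i U Λ b = (coCurlY i U ∘ₗ jordanY i U ∘ₗ curlY i U) Λ b + curv2Y i U Λ b := rfl

/-- ★★★ **`(Δ(e^{iηA′}U₀)Λ)(b)` IS HOLOMORPHIC IN `A′`** on every chart ball `‖A′‖ < R`, for every field `Λ` and bond `b`: print's «Δ_{U′U} … an analytic
function of A» ((3.50), Thm 3.4) kernel-checked AT NODE 00's operator of record `hessY` along pv27's pencil `U′U₀ = prodCfg U₀ η A′`.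
[cite: Balaban1985BackgroundPropagators, (3.10) p.392, Thm 3.4 and (3.50) p.400] -/
theorem differentiableOn_hessY_prodCfg (Λ : FBondY i → 𝔸) (b : FBondY i) :
    DifferentiableOn ℂ (fun a => hessY i (prodCfg U₀ η a) Λ b) (ball (0 : Fin (d + 1) → Site (PV d ℓ i.m i.K hd hL) 0 → 𝔸) Rc) := by
  simp only [hessY_apply_eq]
  exact (differentiableOn_dKd_prodCfg i U₀ η Λ b).add (differentiableOn_curv2Y_prodCfg i U₀ η Λ b)

variable [NormOneClass 𝔸]

open Classical in
/-- ★★★ **… WITH THE BOUND** `‖(Δ(e^{iηA′}U₀)Λ)(b)‖ ≤ [D*𝒦D majorant] + [Δ′₂ majorant]` on `‖A′‖ < R` (`B13OpsYPencilHolonomy.norm_dKd_prodCfg_le` +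
`norm_curv2Y_prodCfg_le`; inputs: `‖U₀(b)^{±1}‖ ≤ K₀`, `1 ≤ K₀`, row sums `c₁ ≥ 0`, `c₂` of `curlK ∕ cocurlK`, the incidence count `N_b`, `c_f`).
[cite: Balaban1985BackgroundPropagators, (3.10) p.392, Thm 3.4 p.400, (3.108) p.416] -/
theorem norm_hessY_prodCfg_le (hU : ∀ μ x, ‖(U₀ μ x : 𝔸)‖ ≤ K₀) (hUi : ∀ μ x, ‖(((U₀ μ x)⁻¹ : 𝔸ˣ) : 𝔸)‖ ≤ K₀) (hK1 : 1 ≤ K₀)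
    (hRc : 0 ≤ Rc) (hc₀ : 0 ≤ c₁) (hc₁ : ∀ p, ∑ b, |curlK i p b| ≤ c₁) (hc₂ : ∀ b, ∑ p, |cocurlK i b p| ≤ c₂) {Nb : ℝ} (b : FBondY i)
    (hNb : (((Finset.univ : Finset (PlaqY i)) ×ˢ (Finset.univ : Finset (Fin 4))).filter fun pm => edgeY i pm.1 pm.2 = b).card ≤ Nb)
    (Λ : FBondY i → 𝔸) {a : Fin (d + 1) → Site (PV d ℓ i.m i.K hd hL) 0 → 𝔸} (ha : a ∈ ball 0 Rc) :
    ‖hessY i (prodCfg U₀ η a) Λ b‖ ≤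
      c₂ * (K₀ * Real.exp (|η| * Rc) *
        ((K₀ * Real.exp (|η| * Rc)) ^ 4 * (c₁ * (K₀ * Real.exp (|η| * Rc) * ‖Λ‖ * (K₀ * Real.exp (|η| * Rc))))) *
        (K₀ * Real.exp (|η| * Rc))) +
      1 / 2 * (Nb * (K₀ * Real.exp (|η| * Rc) *
        (2 * (i.cf ^ 2 * (K₀ * Real.exp (|η| * Rc)) ^ 4) * (8 * (K₀ * Real.exp (|η| * Rc) * ‖Λ‖ * (K₀ * Real.exp (|η| * Rc))))) *
        (K₀ * Real.exp (|η| * Rc)))) := by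
  rw [hessY_apply_eq]
  exact (norm_add_le _ _).trans (add_le_add (norm_dKd_prodCfg_le i U₀ η hU hUi hK1 hRc hc₀ hc₁ hc₂ Λ ha b)
    (norm_curv2Y_prodCfg_le i U₀ η hU hUi hK1 hRc b hNb Λ ha))

end Hessian

/-! ## §4. The N10 coordinates of `Δ(e^{iηA′}U₀)` -/

section Coordinates

variable {κ : Type} (φ : κ → 𝔸 →L[ℂ] ℂ) (e : κ → 𝔸)

/-- ★ **THE COORDINATES OF THE HESSIAN ALONG THE PENCIL ARE HOLOMORPHIC**: `A′ ↦ φ_k((Δ(e^{iηA′}U₀)(δ_x ⊗ e_l))(y))` on every chart ball — the `hEL` ∕ `hAL`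
holomorphy clause of the N10 junction for a local piece built on `Δ(U)` (up to the piece's formula of record and module 68's square packaging).
[cite: Balaban1985BackgroundPropagators, (3.10) p.392, Thm 3.4 and (3.50) p.400; Balaban1988RG2Cluster, (2.5) p.12, p.15] -/
theorem differentiableOn_coord_hessY_prodCfg [DecidableEq (FBondY i)] (y x : FBondY i) (k l : κ) :
    DifferentiableOn ℂ (fun a => φ k (hessY i (prodCfg U₀ η a) (Pi.single x (e l)) y))
      (ball (0 : Fin (d + 1) → Site (PV d ℓ i.m i.K hd hL) 0 → 𝔸) Rc) :=
  (φ k).differentiable.comp_differentiableOn (differentiableOn_hessY_prodCfg i U₀ η (Pi.single x (e l)) y)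

variable [NormOneClass 𝔸]

open Classical in
/-- ★ **… AND BOUNDED**: `‖φ_k((Δ(e^{iηA′}U₀)(δ_x ⊗ e_l))(y))‖ ≤ ‖φ_k‖ · (the §3 majorant at ‖Λ‖ = ‖e_l‖)` on `‖A′‖ < R` (`‖δ_x ⊗ e_l‖ = ‖e_l‖`,
Mathlib `Pi.norm_single`). [cite: Balaban1985BackgroundPropagators, (3.10) p.392, Thm 3.4 p.400, (3.108) p.416] -/
theorem norm_coord_hessY_prodCfg_le (hU : ∀ μ x, ‖(U₀ μ x : 𝔸)‖ ≤ K₀) (hUi : ∀ μ x, ‖(((U₀ μ x)⁻¹ : 𝔸ˣ) : 𝔸)‖ ≤ K₀) (hK1 : 1 ≤ K₀)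
    (hRc : 0 ≤ Rc) {c₁ c₂ : ℝ} (hc₀ : 0 ≤ c₁) (hc₁ : ∀ p, ∑ b, |curlK i p b| ≤ c₁) (hc₂ : ∀ b, ∑ p, |cocurlK i b p| ≤ c₂) {Nb : ℝ}
    (y : FBondY i)
    (hNb : (((Finset.univ : Finset (PlaqY i)) ×ˢ (Finset.univ : Finset (Fin 4))).filter fun pm => edgeY i pm.1 pm.2 = y).card ≤ Nb)
    (x : FBondY i) (k l : κ) {a : Fin (d + 1) → Site (PV d ℓ i.m i.K hd hL) 0 → 𝔸} (ha : a ∈ ball 0 Rc) :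
    ‖φ k (hessY i (prodCfg U₀ η a) (Pi.single x (e l)) y)‖ ≤ ‖φ k‖ *
      (c₂ * (K₀ * Real.exp (|η| * Rc) *
        ((K₀ * Real.exp (|η| * Rc)) ^ 4 * (c₁ * (K₀ * Real.exp (|η| * Rc) * ‖e l‖ * (K₀ * Real.exp (|η| * Rc))))) *
        (K₀ * Real.exp (|η| * Rc))) +
      1 / 2 * (Nb * (K₀ * Real.exp (|η| * Rc) *
        (2 * (i.cf ^ 2 * (K₀ * Real.exp (|η| * Rc)) ^ 4) * (8 * (K₀ * Real.exp (|η| * Rc) * ‖e l‖ * (K₀ * Real.exp (|η| * Rc))))) *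
        (K₀ * Real.exp (|η| * Rc))))) := by
  refine ((φ k).le_opNorm _).trans (mul_le_mul_of_nonneg_left ?_ (norm_nonneg _))
  have h := norm_hessY_prodCfg_le i U₀ η hU hUi hK1 hRc hc₀ hc₁ hc₂ y hNb (Pi.single x (e l)) ha
  rwa [Pi.norm_single] at h

end Coordinates

end Literature.MathematicalPhysics.QuantumFieldTheory.Balaban1983to89.B13OpsYPencilHessian

end
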